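import Literature.AnabelianGeometry.EtaleTheta.LogDivisorModelTateTowerKummerTwistGroupRShear

/-!
# [EtTh] Def. 3.3 (i)(c)/(ii) v3′: the COMPATIBLE part `Ẑ(1)^r ⋊ (Ẑˣ × ℤ_γ)` of the shear-semidirect ζ-twisted Kummer–Tate
# group `Grp′_{r,σ} = K_r ⋊_{(χ,σ)} (C × ℤ_γ)`, and its levels («GRP₃′», compatible part)

S. Mochizuki, *The étale theta function …*, Publ. RIMS **45** (2009) [MochizukiEtTh2009], §1 p.13 (the constant field acts on
`N`-th roots through the cyclotomic character, compatibly in `N`), Prop. 1.4 (ii) p.22 (the translation shear on the functions of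
`Ÿ`), §3 Def. 3.3 (i)(c) p.72, (ii) p.73 [cite: MochizukiEtTh2009, Def 3.3 (ii) p.73].

CLASS (b) DESIGN MODEL, twin of `LogDivisorModelTateTowerKummerTwistGroupRShear.lean` (abc-iut cell, layer L2; abc-iut-L2-lead gen 6
R881: «GRP₃′ SHEAR-SEMIDIRECT» = design of record for TATE TOWER v3 piece 2b(ii); seat abc-iut-L1-t6 g5) — the `σ`-sheared
version of THIS LINEAGE's `…KummerTwistCompatR.lean` (p480175 — UNTOUCHED; `resK`, `resK_apply`, `resK_smul` consumed BY NAME,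
as are `res`, `resC`, `natCast_factorial_eq_zero_iff` of p472997).  The translations act on the index-`n` Kummer classes by the
reduction `σ̄_a` of an INTEGER matrix, so they commute with the restriction maps `ℤ/M_j → ℤ/M_i` (`resK_mulVec_red`): the
compatible families — `k_j ≡ k_i` class by class, `χ_j(c) ≡ χ_i(c)` — still form a subgroup, now `Ẑ(1)^r ⋊ (Ẑˣ × ℤ_γ)` with
`Ẑˣ` acting through THE cyclotomic character and `ℤ_γ` through `σ`.  This file supplies it:
* `resK_mulVec_red` (restriction commutes with `σ̄_a`), `toAdd_left_mul` / `toAdd_left_inv` (coordinates of products/inverses);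
* **`compat r σ : Subgroup (Grp r σ)`**, `isClosed_compat`, `transl_mem_compat` (every translation `(1,(1,a))` is compatible);
* `Compat r σ := ↥(compat r σ)` (subspace topology; Mathlib's subtype instances), `closureC r σ n := Δ_n ∩ compat` — NORMAL, nested,
  PAIRWISE DISTINCT for `r ≠ 0` (`natElt`, `natElt_mem_closureC_iff`, `le_of_closureC_le`), every open neighbourhood of `1`
  containing one (`exists_closureC_subset_of_isOpen`);
* **`levelsC r σ : LevelSystem (Compat r σ)`, both laws PROVED**; the by-name projections a tower needs:
  `coord_eq_zero_of_mem_closureC` (all classes of index `< m` vanish on `closureC r σ m` — the `act_closure_fn/div` input),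
  `resC_right_eq` (χ_j restricts to χ_i — the inflate-equivariance hypothesis of p475183), `res_coord_eq`;
* `r = 3`: `Compat₃' := Compat 3 thetaShear`, `levelsC_three_le_of_closure_le`; `r = 2`: `Compat₂'`.
HONEST LABEL: a combinatorial design model for the v2/v3 interfaces, NOT the tempered fundamental group of a Tate curve; no new
instance; nothing here bears on [IUTchIII] Cor. 3.12; no side taken; typed ≠ proved.
-/

noncomputable section

namespace Literature.AnabelianGeometry.EtaleTheta

open CategoryTheory Function Literature.AlgebraicGeometry.Frobenioids
  Literature.AlgebraicGeometry.Frobenioids.QuasiTemperoid Literature.AnabelianGeometry.SemiGraphs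

namespace TateTowerKummerTwistRShear

open TateTowerKummerTwist (M one_lt_M Cst M_dvd res resC natCast_factorial_eq_zero_iff)
open TateTowerKummerTwistR (KumAdd Kum resK resK_apply resK_smul)

variable (r : ℕ) (σ : Multiplicative ℤ →* Matrix (Fin r) (Fin r) ℤ)

/-! ## Restriction commutes with the integral matrices `σ̄_a` -/

/-- Reduction mod `M j` followed by restriction to `ℤ/M_i` is reduction mod `M i` (entrywise `Int.cast`).
[cite: MochizukiEtTh2009, Def 3.3 (ii) p.73] -/
theorem red_map_res {i j : ℕ} (h : i ≤ j) (A : Matrix (Fin r) (Fin r) ℤ) : (red r j A).map (res h) = red r i A := by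
  ext a b
  simp only [Matrix.map_apply, RingHom.mapMatrix_apply, map_intCast, eq_intCast]

/-- **Restriction commutes with `σ̄_a`**: `res (σ̄_a^{(j)} v) = σ̄_a^{(i)} (res v)` — the matrices are INTEGRAL.
[cite: MochizukiEtTh2009, Def 3.3 (ii) p.73] -/
theorem resK_mulVec_red {i j : ℕ} (h : i ≤ j) (A : Matrix (Fin r) (Fin r) ℤ) (v : Fin r → ZMod (M j)) :
    resK r h (Matrix.mulVec (red r j A) v) = Matrix.mulVec (red r i A) (resK r h v) := by
  funext a
  rw [resK_apply, RingHom.map_mulVec, red_map_res r h]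
  rfl

/-- Coordinates of a product: `(g h)_n = k^g_n + χ_n(c^g) · σ̄_{a^g} k^h_n`. [cite: MochizukiEtTh2009, §1 p.13] -/
theorem toAdd_left_mul (g h : Grp r σ) (n : ℕ) :
    (g * h).left.toAdd n = g.left.toAdd n + (g.right.1 n : ZMod (M n)) • Matrix.mulVec (red r n (σ g.right.2)) (h.left.toAdd n) :=
  rfl

/-- Coordinates of an inverse: `(g⁻¹)_n = χ_n(c^g)⁻¹ · σ̄_{(a^g)⁻¹} (−k^g_n)`. [cite: MochizukiEtTh2009, §1 p.13] -/
theorem toAdd_left_inv (g : Grp r σ) (n : ℕ) :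
    (g⁻¹).left.toAdd n =
      ((g.right.1⁻¹ n : (ZMod (M n))ˣ) : ZMod (M n)) • Matrix.mulVec (red r n (σ g.right.2⁻¹)) (-(g.left.toAdd n)) :=
  rfl

/-- `resK` of a ring-element multiple (twin of `resK_smul` for the coerced unit). [cite: MochizukiEtTh2009, §1 p.13] -/
theorem resK_coe_smul {i j : ℕ} (h : i ≤ j) (u : (ZMod (M j))ˣ) (k : Fin r → ZMod (M j)) :
    resK r h ((u : ZMod (M j)) • k) = (resC h u : ZMod (M i)) • resK r h k :=
  resK_smul r h u k

/-! ## The compatible subgroup -/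

/-- **The compatible subgroup `Ẑ(1)^r ⋊ (Ẑˣ × ℤ_γ) ≤ Grp r σ`**: families of Kummer classes and of cyclotomic-character values compatible
under restriction (a subgroup: restriction is additive, multiplicative on `χ`, and commutes with the integral `σ̄_a`).
[cite: MochizukiEtTh2009, §1 p.13] -/
def compat : Subgroup (Grp r σ) where
  carrier := {g | (∀ i j (h : i ≤ j), resK r h (g.left.toAdd j) = g.left.toAdd i) ∧
    ∀ i j (h : i ≤ j), resC h (g.right.1 j) = g.right.1 i}
  one_mem' := ⟨fun i j h => by rw [SemidirectProduct.one_left, toAdd_one, Pi.zero_apply, Pi.zero_apply, map_zero],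
    fun i j h => by rw [SemidirectProduct.one_right, Prod.fst_one, Pi.one_apply, Pi.one_apply, map_one]⟩
  mul_mem' := by
    rintro a b ⟨ha, ha'⟩ ⟨hb, hb'⟩
    refine ⟨fun i j h => ?_, fun i j h => ?_⟩
    · rw [toAdd_left_mul, toAdd_left_mul, map_add, resK_coe_smul, resK_mulVec_red, ha i j h, hb i j h, ha' i j h]
    · rw [SemidirectProduct.mul_right, Prod.fst_mul, Pi.mul_apply, Pi.mul_apply, map_mul, ha' i j h, hb' i j h]
  inv_mem' := by
    rintro a ⟨ha, ha'⟩
    refine ⟨fun i j h => ?_, fun i j h => ?_⟩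
    · rw [toAdd_left_inv, toAdd_left_inv, resK_coe_smul, resK_mulVec_red, map_neg, ha i j h, Pi.inv_apply, Pi.inv_apply,
        map_inv, ha' i j h]
    · rw [SemidirectProduct.inv_right, Prod.fst_inv, Pi.inv_apply, Pi.inv_apply, map_inv, ha' i j h]

/-- Membership in `compat r σ`. [cite: MochizukiEtTh2009, §1 p.13] -/
theorem mem_compat_iff (g : Grp r σ) : g ∈ compat r σ ↔
    (∀ i j (h : i ≤ j), resK r h (g.left.toAdd j) = g.left.toAdd i) ∧
      ∀ i j (h : i ≤ j), resC h (g.right.1 j) = g.right.1 i := Iff.rfl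

/-- **Every translation `(1, (1, a))` is compatible** (its character values are `1` at every index, its classes `0`).
[cite: MochizukiEtTh2009, Def 3.3 (ii) p.73] -/
theorem transl_mem_compat (a : Multiplicative ℤ) : (SemidirectProduct.inr ((1 : Cst), a) : Grp r σ) ∈ compat r σ :=
  ⟨fun i j h => by rw [SemidirectProduct.left_inr, toAdd_one, Pi.zero_apply, Pi.zero_apply, map_zero],
    fun i j h => by
      change resC h ((1 : Cst) j) = (1 : Cst) i
      rw [Pi.one_apply, Pi.one_apply, map_one]⟩

/-- The Kummer classes of index `j` depend continuously on `g`. [cite: MochizukiEtTh2009, Def 3.3 (ii) p.73] -/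
theorem continuous_coordK (j : ℕ) : Continuous fun g : Grp r σ => g.left.toAdd j :=
  (continuous_apply j).comp (continuous_toAdd.comp (SettingModel.Semidirect.continuous_left (isInducing_leftRight r σ)))

/-- The character value of index `j` depends continuously on `g`. [cite: MochizukiEtTh2009, §1 p.13] -/
theorem continuous_coordC (j : ℕ) : Continuous fun g : Grp r σ => g.right.1 j :=
  (continuous_apply j).comp (continuous_fst.comp (SettingModel.Semidirect.continuous_right (isInducing_leftRight r σ)))

/-- **`compat r σ` is closed** (an intersection of equalisers of continuous maps into discrete spaces). [cite: MochizukiEtTh2009, §1 p.13] -/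
theorem isClosed_compat : IsClosed (compat r σ : Set (Grp r σ)) := by
  change IsClosed {g : Grp r σ | (∀ i j (h : i ≤ j), resK r h (g.left.toAdd j) = g.left.toAdd i) ∧
    ∀ i j (h : i ≤ j), resC h (g.right.1 j) = g.right.1 i}
  simp only [Set.setOf_and, Set.setOf_forall]
  refine IsClosed.inter (isClosed_iInter fun i => isClosed_iInter fun j => isClosed_iInter fun h => isClosed_eq ?_ ?_)
    (isClosed_iInter fun i => isClosed_iInter fun j => isClosed_iInter fun h => isClosed_eq ?_ ?_)
  · exact continuous_of_discreteTopology.comp (continuous_coordK r σ j)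
  · exact continuous_coordK r σ i
  · exact continuous_of_discreteTopology.comp (continuous_coordC r σ j)
  · exact continuous_coordC r σ i

/-- The compatible group `Ẑ(1)^r ⋊ (Ẑˣ × ℤ_γ)` as a topological group (subspace topology). [cite: MochizukiEtTh2009, §1 p.13] -/
abbrev Compat : Type := ↥(compat r σ)

/-! ## Level subgroups of the compatible group -/

/-- `Δ_n ∩ compat`. [cite: MochizukiEtTh2009, Def 3.3 (i) p.72] -/
def closureC (n : ℕ) : Subgroup (Compat r σ) := (closure r σ n).subgroupOf (compat r σ)

/-- Membership in `closureC r σ n`. [cite: MochizukiEtTh2009, Def 3.3 (i) p.72] -/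
theorem mem_closureC_iff (n : ℕ) (g : Compat r σ) : g ∈ closureC r σ n ↔ (g : Grp r σ) ∈ closure r σ n := Subgroup.mem_subgroupOf

/-- `closureC r σ n` is normal. [cite: MochizukiEtTh2009, Def 3.3 (i) p.72] -/
theorem closureC_normal (n : ℕ) : (closureC r σ n).Normal := by
  refine ⟨fun g hg h => ?_⟩
  rw [mem_closureC_iff] at hg ⊢
  rw [Subgroup.coe_mul, Subgroup.coe_mul, Subgroup.coe_inv]
  exact (closure_normal r σ n).conj_mem _ hg _

/-- The `closureC r σ n` are nested. [cite: MochizukiEtTh2009, Def 3.3 (i) p.72] -/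
theorem closureC_antitone {n m : ℕ} (h : n ≤ m) : closureC r σ m ≤ closureC r σ n :=
  fun g hg => (mem_closureC_iff r σ n g).2 (closure_antitone r σ h ((mem_closureC_iff r σ m g).1 hg))

/-- **Every open neighbourhood of `1` in the compatible group contains some `closureC r σ n`.** [cite: MochizukiEtTh2009, Def 3.3 (i) p.72] -/
theorem exists_closureC_subset_of_isOpen {U : Set (Compat r σ)} (hU : IsOpen U) (h1 : (1 : Compat r σ) ∈ U) :
    ∃ n, (closureC r σ n : Set (Compat r σ)) ⊆ U := by
  obtain ⟨V, hV, hVU⟩ := isOpen_induced_iff.1 hU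
  have h1V : (1 : Grp r σ) ∈ V := by
    have : (1 : Compat r σ) ∈ Subtype.val ⁻¹' V := by rw [hVU]; exact h1
    exact this
  obtain ⟨n, hn⟩ := exists_closure_subset_of_isOpen r σ hV h1V
  refine ⟨n, fun g hg => ?_⟩
  rw [← hVU]
  exact hn ((mem_closureC_iff r σ n g).1 hg)

/-- The diagonal compatible element attached to the integer `(j+1)!` on every class (translation and character trivial).
[cite: MochizukiEtTh2009, Def 3.3 (ii) p.73] -/
def natElt (j : ℕ) : Compat r σ :=
  ⟨ofKum r σ (Multiplicative.ofAdd fun n _ => (((j + 1).factorial : ℕ) : ZMod (M n))), by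
    refine ⟨fun i i' h => ?_, fun i i' h => ?_⟩
    · rw [ofKum, SemidirectProduct.left_inl, toAdd_ofAdd]
      exact funext fun _ => map_natCast (res h) _
    · rw [ofKum, SemidirectProduct.right_inl, Prod.fst_one, Pi.one_apply, Pi.one_apply, map_one]⟩

/-- `natElt r σ j ∈ closureC r σ m ↔ m ≤ j` (`r ≠ 0`). [cite: MochizukiEtTh2009, Def 3.3 (i) p.72] -/
theorem natElt_mem_closureC_iff [NeZero r] (j m : ℕ) : natElt r σ j ∈ closureC r σ m ↔ m ≤ j := by
  rw [mem_closureC_iff, natElt, ofKum_mem_closure_iff]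
  simp only [toAdd_ofAdd]
  constructor
  · intro h
    by_contra hm
    have h0 := congrArg (fun f => f (0 : Fin r)) (h j (lt_of_not_ge hm))
    simp only [Pi.zero_apply, natCast_factorial_eq_zero_iff] at h0
    exact lt_irrefl j h0
  · intro h i hi
    exact funext fun _ => (natCast_factorial_eq_zero_iff i j).2 (lt_of_lt_of_le hi h)

/-- `closureC r σ j ≤ closureC r σ i` forces `i ≤ j` (`r ≠ 0`): levels stay pairwise distinct in the compatible group.
[cite: MochizukiEtTh2009, Def 3.3 (i) p.72] -/
theorem le_of_closureC_le [NeZero r] {i j : ℕ} (h : closureC r σ j ≤ closureC r σ i) : i ≤ j :=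
  (natElt_mem_closureC_iff r σ j i).1 (h ((natElt_mem_closureC_iff r σ j j).2 le_rfl))

/-! ## The level of a connected tempered `Compat r σ`-set -/

/-- A point of a tempered `Compat r σ`-set is fixed by some `closureC r σ n`. [cite: MochizukiEtTh2009, Def 3.3 (ii) p.73] -/
theorem exists_closureC_fix (T : BTemp (Compat r σ)) (y : T.obj.V) : ∃ n, ∀ g ∈ closureC r σ n, T.obj.ρ g y = y := by
  obtain ⟨n, hn⟩ := exists_closureC_subset_of_isOpen r σ (T.property.2 y) (BTempConnected.ρ_one_apply T y)
  exact ⟨n, fun g hg => hn hg⟩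

/-- For a CONNECTED tempered `Compat r σ`-set one `closureC r σ n` fixes every point. [cite: MochizukiEtTh2009, Def 3.3 (ii) p.73] -/
theorem exists_closureC_fixes (Y : ConnectedPart (BTemp (Compat r σ))) :
    ∃ n, ∀ g ∈ closureC r σ n, ∀ y : Y.obj.obj.V, Y.obj.obj.ρ g y = y := by
  obtain ⟨y₀⟩ := BTempConnected.nonempty_of_isConnectedObj Y.obj Y.property
  obtain ⟨n, hn⟩ := exists_closureC_fix r σ Y.obj y₀
  refine ⟨n, fun g hg y => ?_⟩
  obtain ⟨h, rfl⟩ := BTempConnected.exists_ρ_eq_of_isConnectedObj Y.obj Y.property y₀ y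
  have hc : h⁻¹ * g * h⁻¹⁻¹ ∈ closureC r σ n := (closureC_normal r σ n).conj_mem g hg h⁻¹
  rw [inv_inv] at hc
  rw [← BTempConnected.ρ_mul_apply, show g * h = h * (h⁻¹ * g * h) by
      rw [← mul_assoc, ← mul_assoc, mul_inv_cancel, one_mul],
    BTempConnected.ρ_mul_apply, hn _ hc]

/-- The level of a connected tempered `Compat r σ`-set. [cite: MochizukiEtTh2009, Def 3.3 (ii) p.73] -/
def lvlC (Y : ConnectedPart (BTemp (Compat r σ))) : ℕ := sInf {n | ∀ g ∈ closureC r σ n, ∀ y : Y.obj.obj.V, Y.obj.obj.ρ g y = y}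

/-- `closureC r σ (lvlC Y)` fixes `Y`. [cite: MochizukiEtTh2009, Def 3.3 (i) p.72] -/
theorem closureC_lvlC_fixes (Y : ConnectedPart (BTemp (Compat r σ))) :
    ∀ g ∈ closureC r σ (lvlC r σ Y), ∀ y : Y.obj.obj.V, Y.obj.obj.ρ g y = y :=
  Nat.sInf_mem (s := {n | ∀ g ∈ closureC r σ n, ∀ y : Y.obj.obj.V, Y.obj.obj.ρ g y = y}) (exists_closureC_fixes r σ Y)

/-- Minimality of the level. [cite: MochizukiEtTh2009, Def 3.3 (i) p.72] -/
theorem lvlC_le {Y : ConnectedPart (BTemp (Compat r σ))} {n : ℕ}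
    (h : ∀ g ∈ closureC r σ n, ∀ y : Y.obj.obj.V, Y.obj.obj.ρ g y = y) : lvlC r σ Y ≤ n :=
  Nat.sInf_le h

/-- Levels are monotone along covering maps. [cite: MochizukiEtTh2009, Def 3.3 (i) p.72] -/
theorem lvlC_le_of_hom {Y Y' : ConnectedPart (BTemp (Compat r σ))} (f : Y' ⟶ Y) : lvlC r σ Y ≤ lvlC r σ Y' := by
  obtain ⟨y'₀⟩ := BTempConnected.nonempty_of_isConnectedObj Y'.obj Y'.property
  refine lvlC_le r σ fun g hg y => ?_
  obtain ⟨y', rfl⟩ := BTempConnected.surjective_of_isConnectedObj y'₀ Y.property f.hom y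
  rw [← BTempConnected.hom_ρ, closureC_lvlC_fixes r σ Y' g hg y']

/-- **The level structure of the compatible shear-semidirect group `Ẑ(1)^r ⋊ (Ẑˣ × ℤ_γ)`** (Def. 3.3 (i)(c)/(ii)): levels `ℕ`,
normal `closureC r σ n`, `lvlC`; BOTH laws PROVED — the `LevelSystem` over which a tower with `r` classes per level and the
Heisenberg-type translation law is equivariant. [cite: MochizukiEtTh2009, Def 3.3 (i) p.72] -/
def levelsC : LevelSystem (Compat r σ) where
  I := ℕ
  closure := closureC r σ
  closure_normal := closureC_normal r σ
  lvl := lvlC r σ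
  closure_lvl_act Y g hg y := closureC_lvlC_fixes r σ Y g hg y
  closure_lvl_mono f := closureC_antitone r σ (lvlC_le_of_hom r σ f)

/-- The levels of `levelsC r σ` are linearly ordered by their closures (`r ≠ 0`). [cite: MochizukiEtTh2009, Def 3.3 (ii) p.73] -/
theorem levelsC_le_of_closure_le [NeZero r] {i j : ℕ} (h : (levelsC r σ).closure j ≤ (levelsC r σ).closure i) : i ≤ j :=
  le_of_closureC_le r σ h

/-- On `closureC r σ m` ALL `r` Kummer classes of index `< m` vanish and the `C × ℤ_γ` component is trivial (the
`act_closure_fn/div` input of a tower). [cite: MochizukiEtTh2009, Def 3.3 (i) p.72] -/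
theorem coord_eq_zero_of_mem_closureC {m : ℕ} {g : Compat r σ} (hg : g ∈ closureC r σ m) (i : ℕ) (hi : i < m) :
    (g : Grp r σ).left.toAdd i = 0 :=
  ((mem_closure_iff r σ m (g : Grp r σ)).1 ((mem_closureC_iff r σ m g).1 hg)).2 i hi

/-- On `closureC r σ m` the `C × ℤ_γ` component is trivial. [cite: MochizukiEtTh2009, Def 3.3 (i) p.72] -/
theorem right_eq_one_of_mem_closureC {m : ℕ} {g : Compat r σ} (hg : g ∈ closureC r σ m) : (g : Grp r σ).right = 1 :=
  ((mem_closure_iff r σ m (g : Grp r σ)).1 ((mem_closureC_iff r σ m g).1 hg)).1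

/-- On the compatible group the index-`j` character value restricts to the index-`i` one. [cite: MochizukiEtTh2009, §1 p.13] -/
theorem resC_right_eq (g : Compat r σ) {i j : ℕ} (h : i ≤ j) : resC h ((g : Grp r σ).right.1 j) = (g : Grp r σ).right.1 i :=
  g.2.2 i j h

/-- On the compatible group the index-`j` Kummer classes restrict to the index-`i` ones, class by class.
[cite: MochizukiEtTh2009, Def 3.3 (ii) p.73] -/
theorem res_coord_eq (g : Compat r σ) {i j : ℕ} (h : i ≤ j) (a : Fin r) :
    res h ((g : Grp r σ).left.toAdd j a) = (g : Grp r σ).left.toAdd i a :=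
  congrArg (fun f => f a) (g.2.1 i j h)

/-! ## `r = 3` and `r = 2` -/

/-- **The compatible part `Ẑ(1)³ ⋊ (Ẑˣ × ℤ_γ)` of «GRP₃′»** (roots of `ϖ̈`, `Ü`, `Θ̈`; translations through the theta shear).
[cite: MochizukiEtTh2009, Def 3.3 (ii) p.73] -/
abbrev Compat₃' : Type := Compat 3 thetaShear

/-- The level structure of `Compat₃'`, levels pairwise distinct. [cite: MochizukiEtTh2009, Def 3.3 (i) p.72] -/
theorem levelsC_three_le_of_closure_le {i j : ℕ}
    (h : (levelsC 3 thetaShear).closure j ≤ (levelsC 3 thetaShear).closure i) : i ≤ j :=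
  levelsC_le_of_closure_le 3 thetaShear h

/-- The compatible part of «GRP₂′» (chain-only tower, both root classes twistable). [cite: MochizukiEtTh2009, Def 3.3 (ii) p.73] -/
abbrev Compat₂' : Type := Compat 2 chainShear

end TateTowerKummerTwistRShear

end Literature.AnabelianGeometry.EtaleTheta

end
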